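import Literature.AlgebraicGeometry.Motives.HodgeThetaSubalgebraUnitaryConstantRankLeviTwo
import Literature.AlgebraicGeometry.Motives.HodgeThetaSubalgebraUnitaryNineElevenCore
import HarnessLib

/-!
# The `Θ`-subalgebra theorem for unitary multiplicities `(9, 20)` — the `r = 6` stall with the residual profile
# `(3, 2)`, closed classification-free by the constant-rank no-go tools B and C (Ribet 1983 Thm. 3, Lie step; abelian
# 29-folds of type `(9, 20)`)

Family `hodge`, layer `Literature/AlgebraicGeometry/Motives` (pure linear algebra over `ℂ`; no geometry). Research
context: cell `pub-hodge-ring2` (HONEST FRAMING: research route conditional on HC_CM; not a corollary; Q11.4-sentence-2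
already refuted in dim ≥ 3), Literature lane gen 86, programme R73. UNCONDITIONAL; theorems only, no definition, no
named fact (D-0026), no `sorry`.

THE PRINT. K. A. Ribet, Amer. J. Math. 105 (1983), Thm. 3 = Gordon's survey Thm. 6.3 (3) [held
`paper:arxiv-alg-geom_9709030` p. 18]: `End⁰ = k` imaginary quadratic acting with coprime multiplicities `(n′, n″)` ⟹
`Hg = U(V, φ)`, `B•(Xⁿ) = D•(Xⁿ)`. The lane replaces Ribet's appeal to the classification of minuscule representations
pair by pair (lit-g85 README §HEIRS: at `(9, 20)` residual profiles `(2,0) (2,2) (2,4) (3,2)`).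

THE ARGUMENT (`UnitaryNineTwenty.eq_top_of_smul`). Ranks `1, 3, 7, 9` are «good» (cores `(1|19)`, `(3|17)`, `(7|13)`,
`(9|11)` — `UnitaryDoubleLevi.eq_top_of_raise_of_core`), `8 → 9` (triple route, `12(9 − ρ) ≠ 8ρ`), and the Ψ-core route
(cores `(7|2)`, `(5|4)`, `(4|5)`) raises the ranks `2, 4, 5`; so if `𝔊 ≠ End(W)` every raising operator has rank in
`{0, 2, 4, 5, 6}` and one of rank `6`, `B`, exists and is maximal. Involution `ι`: `U⁺` of type `(3 | 6)`, `U⁻` of type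
`(6 | 14)`; concrete Levi algebras `L^±` (`UnitaryLeviFull.levi_axioms`); profiles `(i, j) = (rk X|_{U⁺}, rk X|_{U⁻})`
of raising `X` commuting with `ι`. KILLS: `i = 1` (`L⁺` full by `UnitaryRankOneRaise.eq_top_of_rankOne_raise`, then the
maximality polarisation); `j ∈ {1, 3, 5}` (`L⁻` full by `eq_top_of_rankOne_raise`, resp. the cores `(3 | 11)`, `(5 | 9)`
INSIDE `L⁻`). Remaining: `(0,0) (0,2) (0,4) (0,6) (2,0) (2,2) (2,4) (3,2)`. CASE A — some `X` has profile `(3, 2)`: a `Y`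
with profile `(0, 4)` or `(0, 6)` is impossible (generic rank along `X + cY`, whose `U⁺`-part is that of `X`:
`UnitaryGenericRank.exists_finrank_le_finrank_range_add_smul`), and so is an `X'` with profile `(2, 4)` (along `X + cX'`,
for a common `c`, `rk ≥ 3` on `U⁺` and `rk ≥ 4` on `U⁻`: `UnitaryGenericRank.exists_finrank_le_and_finrank_le`); hence
every non-zero raising element of `L⁻` (type `(6 | 14)`) has rank `2` — impossible by tool C
`UnitaryConstantRank.exists_raise_rank_ne_two`. CASE B — no profile `(3, ·)`: every non-zero raising element of `L⁺`
(type `(3 | 6)`) has rank `2` — impossible by tool B `UnitaryThree.exists_raise_rank_ne_two`. Mirror `eq_top_of_smul'`.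

CONSEQUENCE (sequel `HodgeTheory/RibetTypeTwentyNinefoldPowersHodgeClasses`): the `p = 29` census cell `{9, 20}`;
the 29-fold residual becomes `{10, 19}`, `{14, 15}`.

## References
* [Ribet1983] K. A. Ribet, *Hodge classes on certain types of abelian varieties*, Amer. J. Math. 105 (1983), Thm. 3.
* [Gordon1997] B. B. Gordon, *A survey of the Hodge conjecture for abelian varieties*, Thm. 6.3 (3), pp. 18–19.
* [Deligne1982HodgeCycles] P. Deligne, *Hodge cycles on abelian varieties*, LNM 900 (1982), I §3 Prop. 3.4, 3.6.
* [GoodmanWallachGTM255] R. Goodman, N. R. Wallach, GTM 255 (2009), §4.1.1.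
* [Humphreys1972] J. E. Humphreys, *Introduction to Lie Algebras and Representation Theory*, §19.1.
* [HoffmanKunze1971LinearAlgebra] K. Hoffman, R. Kunze, *Linear Algebra* (1971), §3.1 Thm. 2, §6.2, §6.7.
-/

noncomputable section

open Module

namespace Literature.AlgebraicGeometry.Motives

namespace HodgeStructure

universe u

variable {W : Type u} [AddCommGroup W] [Module ℂ W]

/-- **THE `Θ`-SUBALGEBRA THEOREM FOR UNITARY MULTIPLICITIES `(9, 20)` — complex Hermitian core, classification-free.**
`𝔊 ⊆ End(W)` bracket-closed and irreducible, `Θ ∈ 𝔊` an involution with `dim P = 9`, `dim Q = 20`, Hermitian data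
(`s` additive and `ℂ`-homogeneous in the first slot, Hermitian-symmetric, `P ⊥ Q`, definite on `P` and on `Q`), `𝔊`
adjoint-closed ⟹ `𝔊 = End(W)`. See the module docstring. [cite: Ribet1983, Thm. 3] [cite: Gordon1997, Thm. 6.3 (3)]
[cite: Deligne1982HodgeCycles, I §3 Prop. 3.4, 3.6] [cite: GoodmanWallachGTM255, §4.1.1] -/
theorem UnitaryNineTwenty.eq_top_of_smul [FiniteDimensional ℂ W] {𝔊 : Submodule ℂ (Module.End ℂ W)}
    (hbr : ∀ Y ∈ 𝔊, ∀ Z ∈ 𝔊, Y * Z - Z * Y ∈ 𝔊)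
    (hirr : ∀ U : Submodule ℂ W, (∀ A ∈ 𝔊, ∀ u ∈ U, A u ∈ U) → U = ⊥ ∨ U = ⊤)
    {Θ : Module.End ℂ W} (hΘ : Θ ∈ 𝔊) (hΘΘ : Θ * Θ = 1)
    {P Q : Submodule ℂ W} (hP : ∀ x, x ∈ P ↔ Θ x = x) (hQ : ∀ x, x ∈ Q ↔ Θ x = -x)
    (hP9 : Module.finrank ℂ P = 9) (hQ20 : Module.finrank ℂ Q = 20)
    {s : W → W → ℂ} (hadd : ∀ x y z, s (x + y) z = s x z + s y z)
    (hsmul : ∀ (c : ℂ) (x y : W), s (c • x) y = c * s x y) (hsymm : ∀ x y, s y x = starRingEnd ℂ (s x y))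
    (hPQ : ∀ p ∈ P, ∀ q ∈ Q, s p q = 0) (hdefP : ∀ p ∈ P, s p p = 0 → p = 0) (hdefQ : ∀ q ∈ Q, s q q = 0 → q = 0)
    (hadj : ∀ X ∈ 𝔊, ∃ Y ∈ 𝔊, ∀ x y, s (X x) y = s x (Y y)) : 𝔊 = ⊤ := by
  classical
  obtain ⟨haddr, h0r, h0l, hnegr, hnegl, hsubr, hsubl⟩ := UnitaryTwoOdd.herm_right hadd hsymm
  have hΘΘv : ∀ v, Θ (Θ v) = v := fun v => by rw [← Module.End.mul_apply, hΘΘ, Module.End.one_apply]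
  have hraiseval : ∀ Z : Module.End ℂ W, Θ * Z = Z → ∀ w, Z w ∈ P := fun Z hΘZ w =>
    (hP _).2 (by rw [← Module.End.mul_apply, hΘZ])
  have hle9 : ∀ B' : Module.End ℂ W, Θ * B' = B' → Module.finrank ℂ (LinearMap.range B') ≤ 9 := fun B' h => by
    rw [← hP9]
    exact Submodule.finrank_mono (by rintro _ ⟨w, rfl⟩; exact hraiseval B' h w)
  -- the Hermitian data restricted to a subspace
  have hsU : ∀ U : Submodule ℂ W, ∀ x y z : U, s ((x + y : U) : W) z = s (x : W) z + s (y : W) z :=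
    fun U x y z => by simp only [Submodule.coe_add, hadd]
  have hsmU : ∀ U : Submodule ℂ W, ∀ (c : ℂ) (x y : U), s ((c • x : U) : W) y = c * s (x : W) y :=
    fun U c x y => by simp only [Submodule.coe_smul, hsmul]
  -- STEP 1: the good ranks `1, 3, 7, 9`, and `8 → 9`
  have key : ∀ B' ∈ 𝔊, Θ * B' = B' → B' * Θ = -B' →
      (Module.finrank ℂ (LinearMap.range B') = 1 ∨ Module.finrank ℂ (LinearMap.range B') = 3 ∨
        Module.finrank ℂ (LinearMap.range B') = 7 ∨ Module.finrank ℂ (LinearMap.range B') = 9) → 𝔊 = ⊤ := by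
    intro B' hB' hΘB' hB'Θ hr
    refine UnitaryDoubleLevi.eq_top_of_raise_of_core hbr hirr hΘ hΘΘ hP hQ hadd hsymm hPQ hdefP hdefQ hadj hB' hΘB' hB'Θ
      (by omega) (by omega) (by omega)
      fun U 𝔩 ι P' Q' hbr𝔩 hirr𝔩 hι hιι hP' hQ' hfinP' hfinQ' hP'Q' hdefP' hdefQ' hadj𝔩 => ?_
    rw [hQ20] at hfinQ'
    rcases hr with h | h | h | h <;> rw [h] at hfinP' hfinQ'
    · -- `(1 | 19)`: the `(m, 1)` core for `−ι`
      exact UnitaryThreeCoprime.eq_top_of_finrank_eq_one hbr𝔩 hirr𝔩 (Submodule.neg_mem _ hι)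
        ((neg_mul_neg ι ι).trans hιι) (P := Q') (Q := P') (fun x => by rw [hQ', LinearMap.neg_apply, neg_eq_iff_eq_neg])
        (fun x => by rw [hP', LinearMap.neg_apply, neg_inj]) (by omega) hfinP'
    · -- `(3 | 17)`
      exact UnitaryThreeCoprime.eq_top hbr𝔩 hirr𝔩 hι hιι hP' hQ' hfinP' (by omega) (s := fun x y : U => s (x : W) y)
        (hsU U) (fun x y => hsymm x y) hP'Q' hdefP' hdefQ' hadj𝔩
    · -- `(7 | 13)`
      exact UnitarySeven.eq_top_of_smul hbr𝔩 hirr𝔩 hι hιι hP' hQ' hfinP' (by omega) (s := fun x y : U => s (x : W) y)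
        (hsU U) (hsmU U) (fun x y => hsymm x y) hP'Q' hdefP' hdefQ' hadj𝔩
    · -- `(9 | 11)`
      exact UnitaryNine.eq_top_of_smul hbr𝔩 hirr𝔩 hι hιι hP' hQ' hfinP' (by omega) (by omega) (by omega) (by omega)
        (s := fun x y : U => s (x : W) y) (hsU U) (hsmU U) (fun x y => hsymm x y) hP'Q' hdefP' hdefQ' hadj𝔩
  have key8 : ∀ B' ∈ 𝔊, Θ * B' = B' → B' * Θ = -B' → Module.finrank ℂ (LinearMap.range B') = 8 → 𝔊 = ⊤ := by
    intro B' hB' hΘB' hB'Θ h8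
    obtain ⟨B'', hB'', hΘB'', hB''Θ, hgt⟩ :=
      UnitaryRaisingRank.exists_raise_rank_gt_of_finrank_eq_succ_of_smul hbr hirr hΘ hΘΘ hP hQ hB' hΘB' hB'Θ
        (by omega) (by omega) (by omega) (fun ρ h1 h2 => by rw [h8] at h2; rw [h8, hQ20]; omega) hadd hsmul hsymm hPQ
        hdefP hdefQ hadj
    have h9 := hle9 B'' hΘB''
    exact key B'' hB'' hΘB'' hB''Θ (by omega)
  -- STEP 2: otherwise every raising operator has rank in `{0, 2, 4, 5, 6}`
  by_contra hne
  have hbad : ∀ B' ∈ 𝔊, Θ * B' = B' → B' * Θ = -B' →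
      Module.finrank ℂ (LinearMap.range B') = 0 ∨ Module.finrank ℂ (LinearMap.range B') = 2 ∨
        Module.finrank ℂ (LinearMap.range B') = 4 ∨ Module.finrank ℂ (LinearMap.range B') = 5 ∨
        Module.finrank ℂ (LinearMap.range B') = 6 := by
    intro B' hB' hΘB' hB'Θ
    have h9 := hle9 B' hΘB'
    have hk : ¬ (Module.finrank ℂ (LinearMap.range B') = 1 ∨ Module.finrank ℂ (LinearMap.range B') = 3 ∨
        Module.finrank ℂ (LinearMap.range B') = 7 ∨ Module.finrank ℂ (LinearMap.range B') = 9) :=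
      fun h => hne (key B' hB' hΘB' hB'Θ h)
    have hk8 : Module.finrank ℂ (LinearMap.range B') ≠ 8 := fun h => hne (key8 B' hB' hΘB' hB'Θ h)
    omega
  -- STEP 3: the Ψ-core route raises the ranks `2, 4, 5`; a raising operator of rank `6` exists and is maximal
  have hup : ∀ B' ∈ 𝔊, Θ * B' = B' → B' * Θ = -B' →
      (Module.finrank ℂ (LinearMap.range B') = 2 ∨ Module.finrank ℂ (LinearMap.range B') = 4 ∨
        Module.finrank ℂ (LinearMap.range B') = 5) →
      ∃ B'' ∈ 𝔊, Θ * B'' = B'' ∧ B'' * Θ = -B'' ∧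
        Module.finrank ℂ (LinearMap.range B') < Module.finrank ℂ (LinearMap.range B'') := by
    intro B' hB' hΘB' hB'Θ hr
    refine UnitaryRaisingRank.exists_raise_rank_gt_of_psi_core hbr hirr hΘ hΘΘ hP hQ hB' hΘB' hB'Θ (by omega)
      (by rw [hP9]; omega) (by rw [hQ20]; omega) hadd hsymm hPQ hdefP hdefQ hadj
      fun U 𝔩 ι P' Q' hbr𝔩 hirr𝔩 hι hιι hP' hQ' hfinP' hfinQ' hP'Q' hdefP' hdefQ' hadj𝔩 => ?_
    rw [hP9] at hfinP'
    rcases hr with h | h | h <;> rw [h] at hfinP' hfinQ'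
    · -- rank `2`: the `(7 | 2)` core
      exact UnitaryTwoOdd.eq_top' hbr𝔩 hirr𝔩 hι hιι hP' hQ' ⟨3, by omega⟩ hfinQ' (s := fun x y : U => s (x : W) y)
        (hsU U) (fun x y => hsymm x y) hP'Q' hdefP' hdefQ' hadj𝔩
    · -- rank `4`: the `(5 | 4)` core
      exact UnitaryCoprimeStep.eq_top_five_four hbr𝔩 hirr𝔩 hι hιι hP' hQ' (by omega) hfinQ'
        (s := fun x y : U => s (x : W) y) (hsU U) (fun x y => hsymm x y) hP'Q' hdefP' hdefQ' hadj𝔩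
    · -- rank `5`: the `(4 | 5)` core
      exact UnitaryCoprimeStep.eq_top_four_five hbr𝔩 hirr𝔩 hι hιι hP' hQ' (by omega) hfinQ'
        (s := fun x y : U => s (x : W) y) (hsU U) (fun x y => hsymm x y) hP'Q' hdefP' hdefQ' hadj𝔩
  have hno1 : ∀ B' ∈ 𝔊, Θ * B' = B' → B' * Θ = -B' → Module.finrank ℂ (LinearMap.range B') ≠ 1 := by
    intro B' hB' hΘB' hB'Θ h1
    rcases hbad B' hB' hΘB' hB'Θ with h | h | h | h | h <;> omega
  have h6ex : ∃ B ∈ 𝔊, Θ * B = B ∧ B * Θ = -B ∧ Module.finrank ℂ (LinearMap.range B) = 6 := by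
    obtain ⟨B₂, hB₂, hΘB₂, hB₂Θ, hr2⟩ :=
      UnitaryThreeCoprime.exists_raise_rank_ge_two hbr hirr hΘ hΘΘ hP hQ (by omega) (by omega)
    have hfive : ∀ B' ∈ 𝔊, Θ * B' = B' → B' * Θ = -B' → Module.finrank ℂ (LinearMap.range B') = 5 →
        ∃ B ∈ 𝔊, Θ * B = B ∧ B * Θ = -B ∧ Module.finrank ℂ (LinearMap.range B) = 6 := by
      intro B' hB' hΘB' hB'Θ h5
      obtain ⟨B'', hB'', hΘB'', hB''Θ, hgt⟩ := hup B' hB' hΘB' hB'Θ (Or.inr (Or.inr h5))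
      refine ⟨B'', hB'', hΘB'', hB''Θ, ?_⟩
      rcases hbad B'' hB'' hΘB'' hB''Θ with h' | h' | h' | h' | h' <;> omega
    have hfour : ∀ B' ∈ 𝔊, Θ * B' = B' → B' * Θ = -B' → Module.finrank ℂ (LinearMap.range B') = 4 →
        ∃ B ∈ 𝔊, Θ * B = B ∧ B * Θ = -B ∧ Module.finrank ℂ (LinearMap.range B) = 6 := by
      intro B' hB' hΘB' hB'Θ h4
      obtain ⟨B'', hB'', hΘB'', hB''Θ, hgt⟩ := hup B' hB' hΘB' hB'Θ (Or.inr (Or.inl h4))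
      rcases hbad B'' hB'' hΘB'' hB''Θ with h' | h' | h' | h' | h'
      · omega
      · omega
      · omega
      · exact hfive B'' hB'' hΘB'' hB''Θ h'
      · exact ⟨B'', hB'', hΘB'', hB''Θ, h'⟩
    rcases hbad B₂ hB₂ hΘB₂ hB₂Θ with h | h | h | h | h
    · omega
    · obtain ⟨B'', hB'', hΘB'', hB''Θ, hgt⟩ := hup B₂ hB₂ hΘB₂ hB₂Θ (Or.inl h)
      rcases hbad B'' hB'' hΘB'' hB''Θ with h' | h' | h' | h' | h'
      · omega
      · omega
      · exact hfour B'' hB'' hΘB'' hB''Θ h'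
      · exact hfive B'' hB'' hΘB'' hB''Θ h'
      · exact ⟨B'', hB'', hΘB'', hB''Θ, h'⟩
    · exact hfour B₂ hB₂ hΘB₂ hB₂Θ h
    · exact hfive B₂ hB₂ hΘB₂ hB₂Θ h
    · exact ⟨B₂, hB₂, hΘB₂, hB₂Θ, h⟩
  obtain ⟨B, hB, hΘB, hBΘ, h6⟩ := h6ex
  have hmax : ∀ B' ∈ 𝔊, Θ * B' = B' → B' * Θ = -B' →
      Module.finrank ℂ (LinearMap.range B') ≤ Module.finrank ℂ (LinearMap.range B) := by
    intro B' hB' hΘB' hB'Θ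
    rcases hbad B' hB' hΘB' hB'Θ with h | h | h | h | h <;> omega
  -- STEP 4: the involution `ι` of `B`; `U⁺` of type `(3 | 6)`, `U⁻` of type `(6 | 14)`
  obtain ⟨C, hC, ι, hιmem, hBC, hΘC, hCΘ, hιι, hιΘ, hιs, hιa, hιd, hιb, hιc, hmemA, hmemD, hmemB, hmemC, hfinP₀, hfinQ₀,
    hfinQU, hrangeP, hmapCQ, hfinUm, hfinUp⟩ :=
    UnitaryLeviKernel.exists_involution hbr hΘ hΘΘ hP hQ hadd hsymm hPQ hdefP hdefQ hadj hB hΘB hBΘ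
  have hιv : ∀ v, ι (ι v) = v := fun v => by rw [← Module.End.mul_apply, hιι, Module.End.one_apply]
  rw [h6, hP9] at hfinP₀
  rw [h6, hQ20] at hfinQ₀
  rw [h6] at hfinQU
  have hP₀3 : Module.finrank ℂ ↥(P ⊓ LinearMap.ker C) = 3 := by omega
  have hQ₀14 : Module.finrank ℂ ↥(Q ⊓ LinearMap.ker B) = 14 := by omega
  rw [hQ20] at hfinUm
  rw [hP9] at hfinUp
  set Um : Submodule ℂ W := LinearMap.ker (ι + 1) with hUmdef
  set Up : Submodule ℂ W := LinearMap.ker (ι - 1) with hUpdef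
  have hUm : ∀ x, x ∈ Um ↔ ι x = -x := fun x => by
    rw [hUmdef, LinearMap.mem_ker, LinearMap.add_apply, Module.End.one_apply, add_eq_zero_iff_eq_neg]
  have hUp : ∀ x, x ∈ Up ↔ ι x = x := fun x => by
    rw [hUpdef, LinearMap.mem_ker, LinearMap.sub_apply, Module.End.one_apply, sub_eq_zero]
  have hcm : ∀ Z : Module.End ℂ W, Z * ι = ι * Z → ∀ x ∈ Um, Z x ∈ Um := fun Z hZ x hx =>
    (hUm _).2 (by rw [← Module.End.mul_apply, ← hZ, Module.End.mul_apply, (hUm x).1 hx, map_neg])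
  have hcp : ∀ Z : Module.End ℂ W, Z * ι = ι * Z → ∀ x ∈ Up, Z x ∈ Up := fun Z hZ x hx =>
    (hUp _).2 (by rw [← Module.End.mul_apply, ← hZ, Module.End.mul_apply, (hUp x).1 hx])
  obtain ⟨Im, Ip, Lm, Lp, -, -, hLm, hLp, -⟩ := UnitaryLeviKernel.exists_kernel_levi 𝔊 hιι hUm hUp
  -- rank bookkeeping for raising operators commuting with `ι`
  have hsplit : ∀ X : Module.End ℂ W, Θ * X = X → X * ι = ι * X →
      Module.finrank ℂ (LinearMap.range X) = Module.finrank ℂ (Up.map X) + Module.finrank ℂ (Um.map X) ∧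
        Module.finrank ℂ (Up.map X) ≤ 3 ∧ Module.finrank ℂ (Um.map X) ≤ 6 := by
    intro X hΘX hXc
    refine ⟨UnitaryLeviRank.finrank_range_eq_add hιι hUm hUp hXc, ?_, ?_⟩
    · have hle : Up.map X ≤ P ⊓ LinearMap.ker C := by
        rintro _ ⟨x, hx, rfl⟩
        exact hmemB _ ((hUp _).1 (hcp X hXc x hx)) (by rw [← Module.End.mul_apply, hΘX])
      exact (Submodule.finrank_mono hle).trans (by omega)
    · have hle : Um.map X ≤ LinearMap.range B := by
        rintro _ ⟨x, hx, rfl⟩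
        exact hmemA _ ((hUm _).1 (hcm X hXc x hx)) (by rw [← Module.End.mul_apply, hΘX])
      exact (Submodule.finrank_mono hle).trans (by omega)
  -- the concrete Levi algebra `L⁻` (type `(6 | 14)`) satisfies the axioms
  have hPUle : LinearMap.range B ≤ Um := fun x hx => (hUm x).2 (hιa x hx)
  have hQUle : Q ⊓ LinearMap.ker B ≤ Um := fun d hd => (hUm d).2 (hιd d hd)
  have hPUmem : ∀ x ∈ Um, Θ x = x → x ∈ LinearMap.range B := fun x hx hΘx => hmemA x ((hUm x).1 hx) hΘx
  have hPUΘ : ∀ x ∈ LinearMap.range B, Θ x = x := fun x hx => (hP x).1 (hrangeP hx)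
  have hQUmem : ∀ x ∈ Um, Θ x = -x → x ∈ Q ⊓ LinearMap.ker B := fun x hx hΘx => hmemD x ((hUm x).1 hx) hΘx
  have hQUΘ : ∀ x ∈ Q ⊓ LinearMap.ker B, Θ x = -x := fun x hx => (hQ x).1 (Submodule.mem_inf.1 hx).1
  have hPUQU : ∀ x ∈ LinearMap.range B, ∀ y ∈ Q ⊓ LinearMap.ker B, s x y = 0 := fun x hx y hy =>
    hPQ x (hrangeP hx) y (Submodule.mem_inf.1 hy).1
  have hdefPU : ∀ x ∈ LinearMap.range B, s x x = 0 → x = 0 := fun x hx h => hdefP x (hrangeP hx) h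
  have hdefQU : ∀ y ∈ Q ⊓ LinearMap.ker B, s y y = 0 → y = 0 := fun y hy h =>
    hdefQ y (Submodule.mem_inf.1 hy).1 h
  obtain ⟨ιm, Pm, Qm, hιmapply, hPmmem, hQmmem, hbrLm, hirrLm, hιmmem, hιmιm, hPm, hQm, hfinPm, hfinQm, hPmQm, hdefPm,
    hdefQm, hadjLm, -, -⟩ :=
    UnitaryLeviFull.levi_axioms hbr hirr hΘΘ hP hQ hadd hsymm hPQ hdefP hdefQ hadj hιmem hιι hιs hΘ hΘΘ hιΘ hUm hPUle
      hQUle hPUmem hPUΘ hQUmem hQUΘ hPUQU hdefPU hdefQU hLm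
  rw [h6] at hfinPm
  rw [hQ₀14] at hfinQm
  have hfullm_of : Lm = ⊤ → False := by
    intro hLmtop
    have hfullm : ∀ T : Module.End ℂ Um, ∃ Z ∈ 𝔊, Z * ι = ι * Z ∧ ∀ v : Um, ((T v : Um) : W) = Z v := fun T =>
      (hLm T).1 (by rw [hLmtop]; exact Submodule.mem_top)
    obtain ⟨⟨u, hu⟩, hu0⟩ := Module.finrank_pos_iff_exists_ne_zero.1
      (show 0 < Module.finrank ℂ (LinearMap.range B) by omega)
    have hu0' : u ≠ 0 := fun h => hu0 (Subtype.ext h)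
    obtain ⟨⟨q₀, hq₀⟩, hq₀0⟩ := Module.finrank_pos_iff_exists_ne_zero.1
      (show 0 < Module.finrank ℂ ↥(Q ⊓ LinearMap.ker B) by omega)
    have hq₀0' : q₀ ≠ 0 := fun h => hq₀0 (Subtype.ext h)
    obtain ⟨B₁, hB₁, hΘB₁, hB₁Θ, hr1⟩ := UnitaryLeviFull.exists_rankOne_raise_of_full hbr hΘΘ hιι hιΘ hUm hUp hfullm
      (by omega) (by omega) (hPUΘ u hu) (hιa u hu) hu0' (hQUΘ q₀ hq₀) (hιd q₀ hq₀) hq₀0'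
    exact hno1 B₁ hB₁ hΘB₁ hB₁Θ hr1
  -- the concrete Levi algebra `L⁺` (involution `−ι`; type `(3 | 6)`) satisfies the axioms
  have hnι : -ι ∈ 𝔊 := Submodule.neg_mem _ hιmem
  have hnιι : (-ι) * (-ι) = 1 := by rw [neg_mul_neg, hιι]
  have hnιs : ∀ v w, s ((-ι) v) w = s v ((-ι) w) := fun v w => by
    rw [LinearMap.neg_apply, LinearMap.neg_apply, hnegl, hnegr, hιs]
  have hnιΘ : (-ι) * Θ = Θ * (-ι) := by rw [neg_mul, mul_neg, hιΘ]
  have hUp' : ∀ v, v ∈ Up ↔ (-ι) v = -v := fun v => by rw [hUp, LinearMap.neg_apply, neg_inj]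
  have hPUle' : P ⊓ LinearMap.ker C ≤ Up := fun v hv => (hUp v).2 (hιb v hv)
  have hQUle' : P.map C ≤ Up := fun v hv => (hUp v).2 (hιc v hv)
  have hPUmem' : ∀ v ∈ Up, Θ v = v → v ∈ P ⊓ LinearMap.ker C := fun v hv hΘv => hmemB v ((hUp v).1 hv) hΘv
  have hPUΘ' : ∀ v ∈ P ⊓ LinearMap.ker C, Θ v = v := fun v hv => (hP v).1 (Submodule.mem_inf.1 hv).1
  have hQUmem' : ∀ v ∈ Up, Θ v = -v → v ∈ P.map C := fun v hv hΘv => hmemC v ((hUp v).1 hv) hΘv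
  have hQUΘ' : ∀ v ∈ P.map C, Θ v = -v := fun v hv => (hQ v).1 (hmapCQ hv)
  have hPUQU' : ∀ v ∈ P ⊓ LinearMap.ker C, ∀ w ∈ P.map C, s v w = 0 := fun v hv w hw =>
    hPQ v (Submodule.mem_inf.1 hv).1 w (hmapCQ hw)
  have hdefPU' : ∀ v ∈ P ⊓ LinearMap.ker C, s v v = 0 → v = 0 := fun v hv h =>
    hdefP v (Submodule.mem_inf.1 hv).1 h
  have hdefQU' : ∀ w ∈ P.map C, s w w = 0 → w = 0 := fun w hw h => hdefQ w (hmapCQ hw) h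
  have hLp' : ∀ A, A ∈ Lp ↔ ∃ Z ∈ 𝔊, Z * (-ι) = (-ι) * Z ∧ ∀ v : Up, ((A v : Up) : W) = Z v := fun A => by
    rw [hLp]
    constructor
    · rintro ⟨Z, hZ, hZc, hZv⟩; exact ⟨Z, hZ, by rw [mul_neg, neg_mul, hZc], hZv⟩
    · rintro ⟨Z, hZ, hZc, hZv⟩; exact ⟨Z, hZ, by rw [mul_neg, neg_mul, neg_inj] at hZc; exact hZc, hZv⟩
  obtain ⟨ιp, Pp, Qp, hιpapply, hPpmem, hQpmem, hbrLp, hirrLp, hιpmem, hιpιp, hPp, hQp, hfinPp, hfinQp, hPpQp, hdefPp,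
    hdefQp, hadjLp, -, -⟩ :=
    UnitaryLeviFull.levi_axioms hbr hirr hΘΘ hP hQ hadd hsymm hPQ hdefP hdefQ hadj hnι hnιι hnιs hΘ hΘΘ hnιΘ hUp'
      hPUle' hQUle' hPUmem' hPUΘ' hQUmem' hQUΘ' hPUQU' hdefPU' hdefQU' hLp'
  rw [hP₀3] at hfinPp
  rw [hfinQU] at hfinQp
  -- a non-zero vector of `C(P) = Q ∩ U⁺` and two independent vectors of `P ∩ ker C = P ∩ U⁺`
  have hq0 : ∃ q, q ≠ 0 ∧ ι q = q ∧ Θ q = -q := by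
    obtain ⟨⟨q, hq⟩, hq0⟩ := Module.finrank_pos_iff_exists_ne_zero.1
      (show 0 < Module.finrank ℂ ↥(P.map C) by omega)
    exact ⟨q, fun h => hq0 (Subtype.ext h), hιc q hq, (hQ q).1 (hmapCQ hq)⟩
  obtain ⟨c₁, hc₁0, hιc₁, hΘc₁⟩ := hq0
  obtain ⟨⟨e₁, he₁⟩, he₁0⟩ := Module.finrank_pos_iff_exists_ne_zero.1
    (show 0 < Module.finrank ℂ ↥(P ⊓ LinearMap.ker C) by omega)
  have he₁0' : e₁ ≠ 0 := fun h => he₁0 (Subtype.ext h)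
  have hex₂ : ∃ e₂ ∈ P ⊓ LinearMap.ker C, e₂ ∉ ℂ ∙ e₁ := by
    by_contra hall
    push Not at hall
    have hle : P ⊓ LinearMap.ker C ≤ ℂ ∙ e₁ := fun v hv => hall v hv
    have := (Submodule.finrank_mono hle).trans (finrank_span_singleton he₁0').le
    omega
  obtain ⟨e₂, he₂, he₂1⟩ := hex₂
  have hind : ∀ a b : ℂ, a • e₁ + b • e₂ = 0 → a = 0 ∧ b = 0 := by
    intro a b hab
    by_cases hb : b = 0
    · rw [hb, zero_smul, add_zero] at hab
      exact ⟨(smul_eq_zero.1 hab).resolve_right he₁0', hb⟩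
    · exfalso
      apply he₂1
      rw [Submodule.mem_span_singleton]
      refine ⟨-(b⁻¹ * a), ?_⟩
      have : e₂ = b⁻¹ • (b • e₂) := by rw [smul_smul, inv_mul_cancel₀ hb, one_smul]
      rw [this, eq_neg_of_add_eq_zero_right hab]
      module
  -- STEP 5: the kills
  -- (K1) no raising `X` commuting with `ι` has `rk X|_{U⁺} = 1`
  have hkillp1 : ∀ X ∈ 𝔊, Θ * X = X → X * Θ = -X → X * ι = ι * X → Module.finrank ℂ (Up.map X) ≠ 1 := by
    intro X hX hΘX hXΘ hXc hXUp
    set y : Module.End ℂ Up := X.restrict (hcp X hXc) with hydef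
    have hyval : ∀ v : Up, ((y v : Up) : W) = X v := fun v => rfl
    have hymem : y ∈ Lp := (hLp y).2 ⟨X, hX, hXc, hyval⟩
    have hιpy : ιp * y = y := LinearMap.ext fun v => Subtype.ext (by
      rw [Module.End.mul_apply, hιpapply, hyval, ← Module.End.mul_apply, hΘX])
    have hyιp : y * ιp = -y := LinearMap.ext fun v => Subtype.ext (by
      rw [Module.End.mul_apply, LinearMap.neg_apply, Submodule.coe_neg, hyval, hιpapply, ← Module.End.mul_apply, hXΘ,
        LinearMap.neg_apply, hyval])
    have hyrk : Module.finrank ℂ (LinearMap.range y) = 1 := by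
      rw [hydef, UnitaryLeviRank.finrank_range_restrict, hXUp]
    have hLptop : Lp = ⊤ :=
      UnitaryRankOneRaise.eq_top_of_rankOne_raise hbrLp hirrLp hιpmem hιpιp hPp hQp
        (s := fun v w : Up => s (v : W) w) (hsU Up) (fun v w => hsymm v w) hPpQp hdefPp hdefQp hadjLp hymem hιpy hyιp
        hyrk (by rw [hfinPp, hfinQp]; norm_num) (by rw [hfinPp]) (by rw [hfinQp]; norm_num)
    have hfullp : ∀ T : Module.End ℂ Up, ∃ Z ∈ 𝔊, Z * ι = ι * Z ∧ ∀ v : Up, ((T v : Up) : W) = Z v := fun T =>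
      (hLp T).1 (by rw [hLptop]; exact Submodule.mem_top)
    obtain ⟨B₁, hB₁, hΘB₁, hB₁Θ, hr1⟩ := UnitaryLeviFull.exists_rankOne_raise_of_maxRank hbr hΘ hΘΘ hB hΘB hBΘ hmax hιι
      hιΘ (fun w => hιa _ (LinearMap.mem_range_self B w))
      (fun v hιv' hΘv => LinearMap.mem_ker.1 (Submodule.mem_inf.1 (hmemD v hιv' hΘv)).2)
      (fun v hΘv hBv => hιd v (Submodule.mem_inf.2 ⟨(hQ v).2 hΘv, LinearMap.mem_ker.2 hBv⟩)) hUp hfullp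
      (hPUΘ' e₁ he₁) (hιb e₁ he₁) (hPUΘ' e₂ he₂) (hιb e₂ he₂) hind hΘc₁ hιc₁ hc₁0
    exact hno1 B₁ hB₁ hΘB₁ hB₁Θ hr1
  -- (K2) no raising `X` commuting with `ι` has `rk X|_{U⁻} ∈ {1, 3, 5}`
  have hkillm : ∀ X ∈ 𝔊, Θ * X = X → X * Θ = -X → X * ι = ι * X →
      Module.finrank ℂ (Um.map X) ≠ 1 ∧ Module.finrank ℂ (Um.map X) ≠ 3 ∧ Module.finrank ℂ (Um.map X) ≠ 5 := by
    intro X hX hΘX hXΘ hXc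
    set x : Module.End ℂ Um := X.restrict (hcm X hXc) with hxdef
    have hxval : ∀ v : Um, ((x v : Um) : W) = X v := fun v => rfl
    have hxmem : x ∈ Lm := (hLm x).2 ⟨X, hX, hXc, hxval⟩
    have hιmx : ιm * x = x := LinearMap.ext fun v => Subtype.ext (by
      rw [Module.End.mul_apply, hιmapply, hxval, ← Module.End.mul_apply, hΘX])
    have hxιm : x * ιm = -x := LinearMap.ext fun v => Subtype.ext (by
      rw [Module.End.mul_apply, LinearMap.neg_apply, Submodule.coe_neg, hxval, hιmapply, ← Module.End.mul_apply, hXΘ,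
        LinearMap.neg_apply, hxval])
    have hxrk : Module.finrank ℂ (LinearMap.range x) = Module.finrank ℂ (Um.map X) := by
      rw [hxdef, UnitaryLeviRank.finrank_range_restrict]
    have hcore : ∀ k, Module.finrank ℂ (Um.map X) = k → (k = 3 ∨ k = 5) → Lm = ⊤ := by
      intro k hk hk35
      rw [hk] at hxrk
      refine UnitaryDoubleLevi.eq_top_of_raise_of_core hbrLm hirrLm hιmmem hιmιm hPm hQm
        (s := fun v w : Um => s (v : W) w) (hsU Um) (fun v w => hsymm v w) hPmQm hdefPm hdefQm hadjLm hxmem hιmx hxιm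
        (by rw [hxrk]; omega) (by rw [hfinPm]; norm_num) (by rw [hfinPm, hfinQm]; norm_num)
        fun U' 𝔩' ι' P' Q' hbr𝔩' hirr𝔩' hι' hι'ι' hP' hQ' hfinP' hfinQ' hP'Q' hdefP' hdefQ' hadj𝔩' => ?_
      rw [hxrk] at hfinP' hfinQ'
      rw [hfinQm] at hfinQ'
      rcases hk35 with h | h <;> rw [h] at hfinP' hfinQ'
      · -- the `(3 | 11)` core inside `L⁻`
        exact UnitaryThreeCoprime.eq_top hbr𝔩' hirr𝔩' hι' hι'ι' hP' hQ' hfinP' (by omega)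
          (s := fun v w : U' => s ((v : Um) : W) w) (fun v w z => by simp only [Submodule.coe_add, hadd])
          (fun v w => hsymm _ _) hP'Q' hdefP' hdefQ' hadj𝔩'
      · -- the `(5 | 9)` core inside `L⁻`
        exact UnitaryFive.eq_top_of_smul hbr𝔩' hirr𝔩' hι' hι'ι' hP' hQ' hfinP' (by omega)
          (s := fun v w : U' => s ((v : Um) : W) w) (fun v w z => by simp only [Submodule.coe_add, hadd])
          (fun c v w => by simp only [Submodule.coe_smul, hsmul]) (fun v w => hsymm _ _) hP'Q' hdefP' hdefQ' hadj𝔩'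
    refine ⟨fun h1 => ?_, fun h3 => hfullm_of (hcore 3 h3 (Or.inl rfl)), fun h5 => hfullm_of (hcore 5 h5 (Or.inr rfl))⟩
    rw [h1] at hxrk
    exact hfullm_of (UnitaryRankOneRaise.eq_top_of_rankOne_raise hbrLm hirrLm hιmmem hιmιm hPm hQm
      (s := fun v w : Um => s (v : W) w) (hsU Um) (fun v w => hsymm v w) hPmQm hdefPm hdefQm hadjLm hxmem hιmx hxιm
      hxrk (by rw [hfinPm, hfinQm]; norm_num) (by rw [hfinPm]; norm_num) (by rw [hfinQm]; norm_num))
  -- STEP 6: profiles — `rk X|_{U⁺} ∈ {0, 2, 3}`, `rk X|_{U⁻} ∈ {0, 2, 4, 6}`, `(3, j) ⟹ j = 2`, `(2, j) ⟹ j ≠ 6`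
  have hprof : ∀ X ∈ 𝔊, Θ * X = X → X * Θ = -X → X * ι = ι * X →
      (Module.finrank ℂ (Up.map X) = 0 ∨ Module.finrank ℂ (Up.map X) = 2 ∨ Module.finrank ℂ (Up.map X) = 3) ∧
        (Module.finrank ℂ (Up.map X) = 3 → Module.finrank ℂ (Um.map X) = 2) ∧
        (Module.finrank ℂ (Um.map X) = 0 ∨ Module.finrank ℂ (Um.map X) = 2 ∨ Module.finrank ℂ (Um.map X) = 4 ∨
          Module.finrank ℂ (Um.map X) = 6) ∧
        (Module.finrank ℂ (Up.map X) = 2 → Module.finrank ℂ (Um.map X) ≠ 6) := by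
    intro X hX hΘX hXΘ hXc
    obtain ⟨hs, hi, hj⟩ := hsplit X hΘX hXc
    have h1 := hkillp1 X hX hΘX hXΘ hXc
    obtain ⟨hm1, hm3, hm5⟩ := hkillm X hX hΘX hXΘ hXc
    have hr := hbad X hX hΘX hXΘ
    rw [hs] at hr
    refine ⟨by omega, fun h3 => by omega, by omega, fun h2 => by omega⟩
  -- restrictions of sums
  have hres : ∀ (X Y : Module.End ℂ W) (hX : X * ι = ι * X) (hY : Y * ι = ι * Y) (c : ℂ) (U : Submodule ℂ W)
      (hU : ∀ Z : Module.End ℂ W, Z * ι = ι * Z → ∀ x ∈ U, Z x ∈ U) (hXY : (X + c • Y) * ι = ι * (X + c • Y)),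
      (X + c • Y).restrict (hU _ hXY) = X.restrict (hU X hX) + c • Y.restrict (hU Y hY) :=
    fun X Y hX hY c U hU hXY => LinearMap.ext fun v => Subtype.ext (by
      simp only [LinearMap.coe_restrict_apply, LinearMap.add_apply, LinearMap.smul_apply, Submodule.coe_add,
        Submodule.coe_smul])
  have hcomm_add : ∀ (X Y : Module.End ℂ W), X * ι = ι * X → Y * ι = ι * Y → ∀ c : ℂ,
      (X + c • Y) * ι = ι * (X + c • Y) := fun X Y hX hY c => by
    rw [add_mul, smul_mul_assoc, mul_add, mul_smul_comm, hX, hY]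
  by_cases h32 : ∃ X ∈ 𝔊, Θ * X = X ∧ X * Θ = -X ∧ X * ι = ι * X ∧ Module.finrank ℂ (Up.map X) = 3
  · -- CASE A: a profile `(3, 2)`; then every non-zero raising element of `L⁻` has rank `2` — tool C on `(6 | 14)`
    obtain ⟨X, hX, hΘX, hXΘ, hXc, hX3⟩ := h32
    have hX2 : Module.finrank ℂ (Um.map X) = 2 := (hprof X hX hΘX hXΘ hXc).2.1 hX3
    -- (A1) `Y` vanishing on `U⁺` has `rk Y|_{U⁻} ≤ 2`
    have hK : ∀ Y ∈ 𝔊, Θ * Y = Y → Y * Θ = -Y → Y * ι = ι * Y → Module.finrank ℂ (Up.map Y) = 0 →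
        Module.finrank ℂ (Um.map Y) ≤ 2 := by
      intro Y hY hΘY hYΘ hYc hYUp
      have hY0 : ∀ v ∈ Up, Y v = 0 := fun v hv => by
        have : Y v ∈ Up.map Y := Submodule.mem_map_of_mem hv
        rwa [Submodule.finrank_eq_zero.1 hYUp, Submodule.mem_bot] at this
      obtain ⟨c', hc'⟩ := UnitaryGenericRank.exists_finrank_le_finrank_range_add_smul (Y.restrict (hcm Y hYc))
        (X.restrict (hcm X hXc))
      have hX₁c := hcomm_add X Y hXc hYc c'
      have hX₁ : X + c' • Y ∈ 𝔊 := Submodule.add_mem _ hX (Submodule.smul_mem _ _ hY)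
      have hΘX₁ : Θ * (X + c' • Y) = X + c' • Y := by rw [mul_add, mul_smul_comm, hΘX, hΘY]
      have hX₁Θ : (X + c' • Y) * Θ = -(X + c' • Y) := by rw [add_mul, smul_mul_assoc, hXΘ, hYΘ, smul_neg, neg_add]
      have hX₁Up : Up.map (X + c' • Y) = Up.map X := by
        apply le_antisymm
        · rintro _ ⟨v, hv, rfl⟩
          exact ⟨v, hv, by rw [LinearMap.add_apply, LinearMap.smul_apply, hY0 v hv, smul_zero, add_zero]⟩
        · rintro _ ⟨v, hv, rfl⟩
          exact ⟨v, hv, by rw [LinearMap.add_apply, LinearMap.smul_apply, hY0 v hv, smul_zero, add_zero]⟩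
      have hX₁Um : Module.finrank ℂ (Um.map (X + c' • Y)) = 2 :=
        (hprof _ hX₁ hΘX₁ hX₁Θ hX₁c).2.1 (by rw [hX₁Up, hX3])
      rw [← hres X Y hXc hYc c' Um hcm hX₁c, UnitaryLeviRank.finrank_range_restrict,
        UnitaryLeviRank.finrank_range_restrict, hX₁Um] at hc'
      exact hc'
    -- (A2) no profile `(2, 4)`: along `X + c X'` both `rk ≥ 3` on `U⁺` and `rk ≥ 4` on `U⁻` for a common `c`
    have hno24 : ∀ X' ∈ 𝔊, Θ * X' = X' → X' * Θ = -X' → X' * ι = ι * X' → Module.finrank ℂ (Up.map X') = 2 →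
        Module.finrank ℂ (Um.map X') ≠ 4 := by
      intro X' hX' hΘX' hX'Θ hX'c hX'2 hX'4
      obtain ⟨c', hc1, hc2⟩ := UnitaryGenericRank.exists_finrank_le_and_finrank_le
        (X'.restrict (hcm X' hX'c)) (X.restrict (hcm X hXc)) (X.restrict (hcp X hXc)) (X'.restrict (hcp X' hX'c))
      have hZc := hcomm_add X X' hXc hX'c c'
      have hZ : X + c' • X' ∈ 𝔊 := Submodule.add_mem _ hX (Submodule.smul_mem _ _ hX')
      have hΘZ : Θ * (X + c' • X') = X + c' • X' := by rw [mul_add, mul_smul_comm, hΘX, hΘX']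
      have hZΘ : (X + c' • X') * Θ = -(X + c' • X') := by rw [add_mul, smul_mul_assoc, hXΘ, hX'Θ, smul_neg, neg_add]
      rw [← hres X X' hXc hX'c c' Um hcm hZc, UnitaryLeviRank.finrank_range_restrict,
        UnitaryLeviRank.finrank_range_restrict, hX'4] at hc1
      rw [← hres X X' hXc hX'c c' Up hcp hZc, UnitaryLeviRank.finrank_range_restrict,
        UnitaryLeviRank.finrank_range_restrict, hX3] at hc2
      obtain ⟨hZi, hZij, -, -⟩ := hprof _ hZ hΘZ hZΘ hZc
      have hZ3 : Module.finrank ℂ (Up.map (X + c' • X')) = 3 := by omega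
      have := hZij hZ3
      omega
    -- (A3) every non-zero raising element of `L⁻` has rank `2`
    have hconst : ∀ X' ∈ 𝔊, Θ * X' = X' → X' * Θ = -X' → X' * ι = ι * X' →
        Module.finrank ℂ (Um.map X') = 0 ∨ Module.finrank ℂ (Um.map X') = 2 := by
      intro X' hX' hΘX' hX'Θ hX'c
      obtain ⟨hi, hij, hj, h26⟩ := hprof X' hX' hΘX' hX'Θ hX'c
      rcases hi with h | h | h
      · have hk := hK X' hX' hΘX' hX'Θ hX'c h
        omega
      · have h4 := hno24 X' hX' hΘX' hX'Θ hX'c h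
        have h6 := h26 h
        omega
      · exact Or.inr (hij h)
    obtain ⟨A, hA, hιmA, hAιm, hAne, hA2⟩ :=
      UnitaryConstantRank.exists_raise_rank_ne_two hbrLm hirrLm hιmmem hιmιm hPm hQm (by rw [hfinPm]; norm_num)
        (by rw [hfinPm, hfinQm]; norm_num) (by rw [hfinQm]; norm_num)
        (s := fun v w : Um => s (v : W) w) (hsU Um) (fun v w => hsymm v w) hPmQm hdefPm hdefQm hadjLm
    obtain ⟨Z, hZ, hZc, hAZ⟩ := (hLm A).1 hA
    have hZ1 : ∀ u ∈ Um, Θ (Z u) = Z u := fun u hu => by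
      have h := congrArg (fun T => ((T ⟨u, hu⟩ : Um) : W)) hιmA
      simp only [Module.End.mul_apply, hιmapply, hAZ] at h
      exact h
    have hZ2 : ∀ u ∈ Um, Z (Θ u) = -(Z u) := fun u hu => by
      have h := congrArg (fun T => ((T ⟨u, hu⟩ : Um) : W)) hAιm
      simp only [Module.End.mul_apply, LinearMap.neg_apply, Submodule.coe_neg, hAZ] at h
      rw [hιmapply] at h
      exact h
    obtain ⟨X', hX', hΘX', hX'Θ, hX'c, hX'Z⟩ := UnitaryLeviLift.exists_raise_restrict hbr hΘ hΘΘ hιΘ hZ hZc hZ1 hZ2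
    have hxA : X'.restrict (hcm X' hX'c) = A := LinearMap.ext fun v => Subtype.ext (by
      rw [LinearMap.coe_restrict_apply, hX'Z v v.2, hAZ v])
    have hX'Um : Module.finrank ℂ (Um.map X') = Module.finrank ℂ (LinearMap.range A) := by
      rw [← UnitaryLeviRank.finrank_range_restrict (hcm X' hX'c), hxA]
    have hA0 : Module.finrank ℂ (LinearMap.range A) ≠ 0 := fun h =>
      hAne (LinearMap.range_eq_bot.1 (Submodule.finrank_eq_zero.1 h))
    rcases hconst X' hX' hΘX' hX'Θ hX'c with h | h
    · exact hA0 (hX'Um ▸ h)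
    · exact hA2 (hX'Um ▸ h)
  · -- CASE B: no profile `(3, ·)`; then every non-zero raising element of `L⁺` has rank `2` — tool B on `(3 | 6)`
    have hprof2 : ∀ X ∈ 𝔊, Θ * X = X → X * Θ = -X → X * ι = ι * X →
        Module.finrank ℂ (Up.map X) = 0 ∨ Module.finrank ℂ (Up.map X) = 2 := by
      intro X hX hΘX hXΘ hXc
      rcases (hprof X hX hΘX hXΘ hXc).1 with h | h | h
      · exact Or.inl h
      · exact Or.inr h
      · exact absurd ⟨X, hX, hΘX, hXΘ, hXc, h⟩ h32
    obtain ⟨A, hA, hιpA, hAιp, hAne, hA2⟩ :=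
      UnitaryThree.exists_raise_rank_ne_two hbrLp hirrLp hιpmem hιpιp hPp hQp hfinPp (by rw [hfinQp]; norm_num)
        (s := fun v w : Up => s (v : W) w) (hsU Up) (fun v w => hsymm v w) hPpQp hdefPp hdefQp hadjLp
    obtain ⟨Z, hZ, hZc, hAZ⟩ := (hLp A).1 hA
    have hZ1 : ∀ u ∈ Up, Θ (Z u) = Z u := fun u hu => by
      have h := congrArg (fun T => ((T ⟨u, hu⟩ : Up) : W)) hιpA
      simp only [Module.End.mul_apply, hιpapply, hAZ] at h
      exact h
    have hZ2 : ∀ u ∈ Up, Z (Θ u) = -(Z u) := fun u hu => by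
      have h := congrArg (fun T => ((T ⟨u, hu⟩ : Up) : W)) hAιp
      simp only [Module.End.mul_apply, LinearMap.neg_apply, Submodule.coe_neg, hAZ] at h
      rw [hιpapply] at h
      exact h
    obtain ⟨X, hX, hΘX, hXΘ, hXc, hXZ⟩ := UnitaryLeviLift.exists_raise_restrict hbr hΘ hΘΘ hιΘ hZ hZc hZ1 hZ2
    have hxA : X.restrict (hcp X hXc) = A := LinearMap.ext fun v => Subtype.ext (by
      rw [LinearMap.coe_restrict_apply, hXZ v v.2, hAZ v])
    have hXUp : Module.finrank ℂ (Up.map X) = Module.finrank ℂ (LinearMap.range A) := by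
      rw [← UnitaryLeviRank.finrank_range_restrict (hcp X hXc), hxA]
    have hA0 : Module.finrank ℂ (LinearMap.range A) ≠ 0 := fun h =>
      hAne (LinearMap.range_eq_bot.1 (Submodule.finrank_eq_zero.1 h))
    rcases hprof2 X hX hΘX hXΘ hXc with h | h
    · exact hA0 (hXUp ▸ h)
    · exact hA2 (hXUp ▸ h)

/-- **The mirror core `(20, 9)`** (apply `eq_top_of_smul` to `−Θ`). [cite: Ribet1983, Thm. 3]
[cite: Gordon1997, Thm. 6.3 (3)] -/
theorem UnitaryNineTwenty.eq_top_of_smul' [FiniteDimensional ℂ W] {𝔊 : Submodule ℂ (Module.End ℂ W)}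
    (hbr : ∀ Y ∈ 𝔊, ∀ Z ∈ 𝔊, Y * Z - Z * Y ∈ 𝔊)
    (hirr : ∀ U : Submodule ℂ W, (∀ A ∈ 𝔊, ∀ u ∈ U, A u ∈ U) → U = ⊥ ∨ U = ⊤)
    {Θ : Module.End ℂ W} (hΘ : Θ ∈ 𝔊) (hΘΘ : Θ * Θ = 1)
    {P Q : Submodule ℂ W} (hP : ∀ x, x ∈ P ↔ Θ x = x) (hQ : ∀ x, x ∈ Q ↔ Θ x = -x)
    (hP20 : Module.finrank ℂ P = 20) (hQ9 : Module.finrank ℂ Q = 9)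
    {s : W → W → ℂ} (hadd : ∀ x y z, s (x + y) z = s x z + s y z)
    (hsmul : ∀ (c : ℂ) (x y : W), s (c • x) y = c * s x y) (hsymm : ∀ x y, s y x = starRingEnd ℂ (s x y))
    (hPQ : ∀ p ∈ P, ∀ q ∈ Q, s p q = 0) (hdefP : ∀ p ∈ P, s p p = 0 → p = 0) (hdefQ : ∀ q ∈ Q, s q q = 0 → q = 0)
    (hadj : ∀ X ∈ 𝔊, ∃ Y ∈ 𝔊, ∀ x y, s (X x) y = s x (Y y)) : 𝔊 = ⊤ := by
  have hnΘ : -Θ ∈ 𝔊 := Submodule.neg_mem _ hΘ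
  have hnΘΘ : (-Θ) * (-Θ) = 1 := by rw [neg_mul_neg, hΘΘ]
  exact UnitaryNineTwenty.eq_top_of_smul hbr hirr hnΘ hnΘΘ (P := Q) (Q := P)
    (fun x => by rw [hQ, LinearMap.neg_apply, neg_eq_iff_eq_neg]) (fun x => by rw [hP, LinearMap.neg_apply, neg_inj])
    hQ9 hP20 hadd hsmul hsymm (fun p hp q hq => by rw [hsymm, hPQ q hq p hp, map_zero]) hdefQ hdefP hadj

end HodgeStructure

end Literature.AlgebraicGeometry.Motives
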